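import Summits.PneNP.PneNP.Theorems.ChebyshevTracialDesignHalfPairsNull
import HarnessLib

/-!
# Cell pnp-psdrank, route `ChebyshevTracialDesign`: tools for the crossing-plane reduction — level-quadratic profiles are pure
# remainders; `cc^j`-weighted design values; the pointwise expansion of the tilted mask (crux `TracialDecayExp20`, stmt-PneNP-19878)

Brick 120a (prover g22; MEMO-25 §2(c)). Pieces of brick 120 (`…CrossingPlaneReduction`), kept apart for size:
* §1 **`abs_levelSum_levelSqMul_le`**: for `(C, w)` exact of degree `D` on odd levels `≤ T` (variation `≤ B`, `2D+1 ≤ T`) and a profile `θ` with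
  `|Δ^k θ_odd| ≤ K_k` (`k ≤ D+1`): `|Σ_c w_c·c²·θ(c)| ≤ (2D+1)(C(2D,D)/4^D)·K′_D + B·C((T−1)/2,D+1)·(T·K′_{D+1} + 2(D+1)·K′_D)`,
  `K′_k = T·K_k + 2k·K_{k−1}` — brick 119 §1 (`abs_levelSum_levelMul_le`) applied to `c·θ(c)` with Boole's Leibniz rule for the node factor.
* §2 `levelWeight_eq_zero_of_card_ne` (the planted weight lives on the `t`-cuts), **`designValue_ccPow_eq_shellAvg`**
  (`Σ_U W(U,M)·cc(U,M)^j·g(U) = |PM|⁻¹ Σ_c w_c c^j E_{Shell_c(M)}[g]`).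
* §3 `pointwise_expansion` (the ring identity `ψ(2λ(X−Y)+κ(t−c))² = ψ₀ − 2κcψ₁ + κ²c²ψ − 4λYψ₁ + 4λκcYψ + 4λ²Yψ + 4λ²Y(Y−1)ψ`,
  `ψ₁ = ψ·(2λX+κt)`, `ψ₀ = ψ·(2λX+κt)²`) and `abs_seven_le` (the matching seven-term triangle inequality for `|λ|, |κ| ≤ 1`).
WHAT THIS FILE DOES NOT DO: the reduction itself (brick 120); anything on `TracialDecayExp20`, psd rank, or P vs NP.
[cite: Rothvoss2017, §2 (PDF p. 6)] [cite: Agarwal2000DifferenceEquations, Thm. 1.8.5 (1.8.6), Remark 1.8.1 (1.8.8)]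
[cite: Boole2009, Ch. II Art. 10 Ex. 3 eq. (8) (PDF pp. 34–35)]
Stature: support/instrument (kernel lane, no defs, axioms standard). Supports stmt-PneNP-19878.
-/

set_option linter.dupNamespace false -- `Summit.PneNP.PneNP.…`: summit = sub-problem (D-0017)

noncomputable section

namespace Summit.PneNP.PneNP.Theorems.ChebyshevTracialDesignCrossingPlaneTools

open Finset Polynomial Literature.Barriers.PneNP Literature.Combinatorics.Optimization
open Literature.Combinatorics.Optimization.ShellStep
open Summit.PneNP.PneNP.Theorems.ChebyshevTracialDesignShellOperatorForm (designValue_eq_shellAvg)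
open Summit.PneNP.PneNP.Theorems.ChebyshevTracialDesignHalfPinnedNull (fwdDiff_iter_levelMul abs_levelSum_levelMul_le)

variable {n : ℕ}

/-! ### §1 Level-quadratic profiles are pure remainders -/

/-- **Design value of `c²·θ(c)` is a pure remainder**: for `(C, w)` exact of degree `D` on odd levels `≤ T`, variation `≤ B`, `2D+1 ≤ T`,
and `|Δ^k θ_odd(j)| ≤ K_k` for `k ≤ D+1`, `2(j+k)+1 ≤ T`:
`|Σ_c w_c·c²·θ(c)| ≤ (2D+1)(C(2D,D)/4^D)·K′_D + B·C((T−1)/2,D+1)·(T·K′_{D+1} + 2(D+1)·K′_D)`, `K′_k = T·K_k + 2k·K_{k−1}` (brick 119 §1 applied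
to `c·θ(c)`, Leibniz for the node factor). [cite: Agarwal2000DifferenceEquations, Remark 1.8.1 (1.8.8)] -/
theorem abs_levelSum_levelSqMul_le {C : Finset ℕ} {w : ℕ → ℝ} {D : ℕ}
    (hex : ∀ p : ℝ[X], p.natDegree ≤ D → ∑ c ∈ C, w c * p.eval (c : ℝ) = -p.eval 0)
    {B : ℝ} (hB : ∑ c ∈ C, |w c| ≤ B) {T : ℕ} (hT : ∀ c ∈ C, c ≤ T) (hodd : ∀ c ∈ C, Odd c) (hDT : 2 * D + 1 ≤ T)
    (θ : ℕ → ℝ) (K : ℕ → ℝ) (hK0 : ∀ k, 0 ≤ K k)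
    (hK : ∀ k, k ≤ D + 1 → ∀ j : ℕ, 2 * (j + k) + 1 ≤ T → |((fwdDiff (1 : ℕ))^[k] (fun j => θ (2 * j + 1))) j| ≤ K k) :
    |∑ c ∈ C, w c * ((c : ℝ) ^ 2 * θ c)| ≤
      (2 * (D : ℝ) + 1) * ((((2 * D).choose D : ℕ) : ℝ) / (4 : ℝ) ^ D) * ((T : ℝ) * K D + 2 * (D : ℝ) * K (D - 1)) +
        B * ((((T - 1) / 2).choose (D + 1) : ℕ) : ℝ) *
          ((T : ℝ) * ((T : ℝ) * K (D + 1) + 2 * ((D : ℝ) + 1) * K D) +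
            2 * ((D : ℝ) + 1) * ((T : ℝ) * K D + 2 * (D : ℝ) * K (D - 1))) := by
  have hsq : ∀ c : ℕ, w c * ((c : ℝ) ^ 2 * θ c) = w c * ((c : ℝ) * ((fun c : ℕ => (c : ℝ) * θ c) c)) := by
    intro c; ring
  rw [sum_congr rfl fun c _ => hsq c]
  have hsub : (fun j : ℕ => (fun c : ℕ => (c : ℝ) * θ c) (2 * j + 1)) = fun j : ℕ => (2 * (j : ℝ) + 1) * θ (2 * j + 1) := by
    funext j; push_cast; ring
  -- `|Δ^k[(2j+1)θ_odd](j)| ≤ T·K_k + 2k·K_{k−1}`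
  have hK' : ∀ k, k ≤ D + 1 → ∀ j : ℕ, 2 * (j + k) + 1 ≤ T →
      |((fwdDiff (1 : ℕ))^[k] (fun j => (fun c : ℕ => (c : ℝ) * θ c) (2 * j + 1))) j| ≤ (T : ℝ) * K k + 2 * (k : ℝ) * K (k - 1) := by
    intro k hk j hj
    rw [hsub, fwdDiff_iter_levelMul]
    have hjT : 2 * (j : ℝ) + 1 ≤ T := by exact_mod_cast (show 2 * j + 1 ≤ T by omega)
    have h1 := hK k hk j hj
    have h2 : |2 * (k : ℝ) * (fwdDiff (1 : ℕ))^[k - 1] (fun j => θ (2 * j + 1)) (j + 1)| ≤ 2 * (k : ℝ) * K (k - 1) := by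
      by_cases hk0 : k = 0
      · rw [hk0]; simp
      · rw [abs_mul, abs_of_nonneg (by positivity : (0 : ℝ) ≤ 2 * (k : ℝ))]
        exact mul_le_mul_of_nonneg_left (hK (k - 1) (by omega) (j + 1) (by omega)) (by positivity)
    calc |(2 * (j : ℝ) + 1) * (fwdDiff (1 : ℕ))^[k] (fun j => θ (2 * j + 1)) j +
            2 * (k : ℝ) * (fwdDiff (1 : ℕ))^[k - 1] (fun j => θ (2 * j + 1)) (j + 1)|
        ≤ |(2 * (j : ℝ) + 1) * (fwdDiff (1 : ℕ))^[k] (fun j => θ (2 * j + 1)) j| +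
            |2 * (k : ℝ) * (fwdDiff (1 : ℕ))^[k - 1] (fun j => θ (2 * j + 1)) (j + 1)| := abs_add_le _ _
      _ ≤ (T : ℝ) * K k + 2 * (k : ℝ) * K (k - 1) := by
          rw [abs_mul, abs_of_nonneg (by positivity : (0 : ℝ) ≤ 2 * (j : ℝ) + 1)]
          exact add_le_add (mul_le_mul hjT h1 (abs_nonneg _) (Nat.cast_nonneg _)) h2
  have hK'0 : ∀ k, 0 ≤ (T : ℝ) * K k + 2 * (k : ℝ) * K (k - 1) := fun k => by
    have := hK0 k; have := hK0 (k - 1); positivity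
  have h := abs_levelSum_levelMul_le hex hB hT hodd hDT (fun c : ℕ => (c : ℝ) * θ c) (hK'0 D) (hK'0 (D + 1))
    (fun j hj => hK' D (by omega) j hj) (fun j hj => hK' (D + 1) le_rfl j hj)
  simpa only [Nat.cast_add, Nat.cast_one, Nat.add_sub_cancel] using h

/-! ### §2 Crossing-number-weighted design values are level-weighted shell averages -/

/-- The planted weight lives on the `t`-cuts: `W(U,M) = 0` unless `|U| = t`. [cite: Rothvoss2017, §2 (PDF p. 6)] -/
theorem levelWeight_eq_zero_of_card_ne (t : ℕ) (C : Finset ℕ) (w : ℕ → ℝ) (U : OddSet n) (M : PMatch n)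
    (hU : U.1.card ≠ t) : levelWeight n t C w U M = 0 := by
  unfold levelWeight
  refine sum_eq_zero fun c _ => ?_
  rw [if_neg]
  exact fun h => hU (mem_Qset_iff.1 h).1

/-- **`cc^j`-weighted design values**: `Σ_U W(U,M)·cc(U,M)^j·g(U) = |PM|⁻¹·Σ_c w_c·c^j·E_{Shell_c(M)}[g]`.
[cite: Rothvoss2017, §2 (PDF p. 6)] -/
theorem designValue_ccPow_eq_shellAvg (t : ℕ) (ht : Odd t) (C : Finset ℕ) (w : ℕ → ℝ) (M : PMatch n)
    (g : Finset (Fin n) → ℝ) (j : ℕ) :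
    ∑ U : OddSet n, levelWeight n t C w U M * ((cc U M : ℝ) ^ j * g U.1) =
      (Fintype.card (PMatch n) : ℝ)⁻¹ * ∑ c ∈ C, w c * ((c : ℝ) ^ j *
        ((∑ U' ∈ shell M.2.partner t c, g U') / (shell M.2.partner t c).card)) := by
  have h := designValue_eq_shellAvg t ht C w M (fun U₁ : Finset (Fin n) => (((half M.2.partner U₁).card : ℝ)) ^ j * g U₁)
  simp only [cc_eq_card_half]
  rw [h]
  congr 1
  refine sum_congr rfl fun c _ => ?_
  congr 1
  rw [← mul_div_assoc, mul_sum]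
  congr 1
  refine sum_congr rfl fun U' hU' => ?_
  rw [(mem_shell.1 hU').2]

/-! ### §3 The pointwise expansion and the seven-term triangle inequality -/

/-- **Pointwise expansion of the tilted mask in the crossing plane.** With `A = 2λX + κt`, `Y` the half count and `cc` the crossing number
(so that `C_u = 2λ(X − Y) + κ(t − cc)` on a `t`-cut):
`ψ·(2λ(X−Y) + κ(t−cc))² = ψA² − 2κ·cc·ψA + κ²·cc²·ψ − 4λ·Y·ψA + 4λκ·cc·Y·ψ + 4λ²·Y·ψ + 4λ²·Y(Y−1)·ψ` (ring identity).
[cite: Rothvoss2017, §2 (PDF p. 6)] -/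
theorem pointwise_expansion (ψv X Y c t lam kap : ℝ) :
    ψv * (2 * lam * (X - Y) + kap * (t - c)) ^ 2 =
      ψv * (2 * lam * X + kap * t) ^ 2 - 2 * kap * (c * (ψv * (2 * lam * X + kap * t))) + kap ^ 2 * (c ^ 2 * ψv) -
        4 * lam * (Y * (ψv * (2 * lam * X + kap * t))) + 4 * lam * kap * (c * (Y * ψv)) + 4 * lam ^ 2 * (Y * ψv) +
          4 * lam ^ 2 * (Y * (Y - 1) * ψv) := by
  ring

/-- **Seven-term triangle inequality** with the crossing-plane coefficients (`|λ|, |κ| ≤ 1`). [folklore] -/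
theorem abs_seven_le {lam kap : ℝ} (hlam : |lam| ≤ 1) (hkap : |kap| ≤ 1)
    (P a0 a1 a2 a3 a4 a5 a6 N b0 b1 b2 b3 b4 b5 b6 : ℝ)
    (h0 : |P * a0 + N| ≤ b0) (h1 : |P * a1| ≤ b1) (h2 : |P * a2| ≤ b2) (h3 : |P * a3| ≤ b3) (h4 : |P * a4| ≤ b4)
    (h5 : |P * a5| ≤ b5) (h6 : |P * a6| ≤ b6) :
    |P * (a0 + (-2 * kap) * a1 + kap ^ 2 * a2 + (-4 * lam) * a3 + (4 * lam * kap) * a4 + (4 * lam ^ 2) * a5 +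
        (4 * lam ^ 2) * a6) + N| ≤ b0 + 2 * b1 + b2 + 4 * b3 + 4 * b4 + 4 * b5 + 4 * b6 := by
  have c1 : |-2 * kap| ≤ 2 := by rw [abs_mul, abs_neg]; norm_num; linarith
  have c2 : |kap ^ 2| ≤ 1 := by rw [abs_pow]; nlinarith [abs_nonneg kap]
  have c3 : |-4 * lam| ≤ 4 := by rw [abs_mul, abs_neg]; norm_num; linarith
  have c4 : |4 * lam * kap| ≤ 4 := by
    rw [abs_mul, abs_mul]; norm_num; nlinarith [abs_nonneg lam, abs_nonneg kap]
  have c5 : |4 * lam ^ 2| ≤ 4 := by rw [abs_mul, abs_pow]; norm_num; nlinarith [abs_nonneg lam]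
  have e : P * (a0 + (-2 * kap) * a1 + kap ^ 2 * a2 + (-4 * lam) * a3 + (4 * lam * kap) * a4 + (4 * lam ^ 2) * a5 +
      (4 * lam ^ 2) * a6) + N = (P * a0 + N) + ((-2 * kap) * (P * a1) + kap ^ 2 * (P * a2) + (-4 * lam) * (P * a3) +
        (4 * lam * kap) * (P * a4) + (4 * lam ^ 2) * (P * a5) + (4 * lam ^ 2) * (P * a6)) := by ring
  rw [e]
  have m1 : |(-2 * kap) * (P * a1)| ≤ 2 * b1 := by rw [abs_mul]; exact mul_le_mul c1 h1 (abs_nonneg _) (by norm_num)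
  have m2 : |kap ^ 2 * (P * a2)| ≤ b2 := by
    rw [abs_mul]
    calc |kap ^ 2| * |P * a2| ≤ 1 * b2 := mul_le_mul c2 h2 (abs_nonneg _) (by norm_num)
      _ = b2 := one_mul _
  have m3 : |(-4 * lam) * (P * a3)| ≤ 4 * b3 := by rw [abs_mul]; exact mul_le_mul c3 h3 (abs_nonneg _) (by norm_num)
  have m4 : |(4 * lam * kap) * (P * a4)| ≤ 4 * b4 := by rw [abs_mul]; exact mul_le_mul c4 h4 (abs_nonneg _) (by norm_num)
  have m5 : |(4 * lam ^ 2) * (P * a5)| ≤ 4 * b5 := by rw [abs_mul]; exact mul_le_mul c5 h5 (abs_nonneg _) (by norm_num)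
  have m6 : |(4 * lam ^ 2) * (P * a6)| ≤ 4 * b6 := by rw [abs_mul]; exact mul_le_mul c5 h6 (abs_nonneg _) (by norm_num)
  have s0 := abs_add_le (P * a0 + N) ((-2 * kap) * (P * a1) + kap ^ 2 * (P * a2) + (-4 * lam) * (P * a3) +
    (4 * lam * kap) * (P * a4) + (4 * lam ^ 2) * (P * a5) + (4 * lam ^ 2) * (P * a6))
  have s6 := abs_add_le ((-2 * kap) * (P * a1) + kap ^ 2 * (P * a2) + (-4 * lam) * (P * a3) +
    (4 * lam * kap) * (P * a4) + (4 * lam ^ 2) * (P * a5)) ((4 * lam ^ 2) * (P * a6))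
  have s5 := abs_add_le ((-2 * kap) * (P * a1) + kap ^ 2 * (P * a2) + (-4 * lam) * (P * a3) +
    (4 * lam * kap) * (P * a4)) ((4 * lam ^ 2) * (P * a5))
  have s4 := abs_add_le ((-2 * kap) * (P * a1) + kap ^ 2 * (P * a2) + (-4 * lam) * (P * a3)) ((4 * lam * kap) * (P * a4))
  have s3 := abs_add_le ((-2 * kap) * (P * a1) + kap ^ 2 * (P * a2)) ((-4 * lam) * (P * a3))
  have s2 := abs_add_le ((-2 * kap) * (P * a1)) (kap ^ 2 * (P * a2))
  linarith only [s0, s2, s3, s4, s5, s6, m1, m2, m3, m4, m5, m6, h0]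

end Summit.PneNP.PneNP.Theorems.ChebyshevTracialDesignCrossingPlaneTools

end
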